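import Summits.Ventures.HSemireg.WedgeHankelRecurrenceGaussChebyshevDerivativesAtOne

/-!
# Venture HSemireg — **ALL DERIVATIVES OF `S_n, C_n` ARE `≥ 0` ON `[2, ∞)` AND ALL DERIVATIVES OF `T_n, U_n` ARE `≥ 0` ON `[1, ∞)`** (the Taylor coefficients at the endpoint are `≥ 0`, N549 ∕ N551, and a polynomial whose
# Taylor coefficients at `a` are all `≥ 0` has all derivatives `≥ 0` on `[a, ∞)`: `p^{(k)}(x) = k!·(p(X + x))_k`, `p(X + x) = p(X + a)∘(X + (x − a))`, `((X + c)^i)_k = C(i,k)c^{i−k}`)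

HONEST FRAMING. Part of the Lean index of the computation cell `pub-hsemireg` (seat p10 gen 49, Sunday typer «UNIFORM-IN-n»).  Polynomial algebra with the formal derivative and real inequalities (Mathlib
`Polynomial.derivative`, `coeff_X_add_C_pow`, `Polynomial.Chebyshev.T ∕ U ∕ C ∕ S`); no variety, no cohomology theory, no sheaf, no Ext group and no semiregularity map is constructed here; nothing here says
that HC / HC_CM / HC_AV holds; no Literature fact (unproved `Prop`) is declared or used.  Custodian versions as in `WedgeHankelSiegelIdeal` (1/3).
SOURCES (cited).  T. J. Rivlin, *The Chebyshev Polynomials* (Wiley 1974), §1.5 (1.97)–(1.98) and §2.7 (`T_n^{(k)} ≥ 0` on `[1, ∞)`, the extremal property of `T_n^{(k)}` outside the interval); P. Borwein,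
T. Erdélyi, *Polynomials and Polynomial Inequalities* (Springer 1995), §5.1.
PROOF TYPED HERE.  As in the title: `coeff_comp_X_add_C_nonneg` (`Polynomial.comp_eq_sum_left`, `coeff_X_add_C_pow`, `Finset.sum_nonneg`), `iterate_derivative_eval_nonneg_of_coeff_comp_nonneg` (N551
`iterate_derivative_eval_eq_factorial_mul_coeff`, `comp_assoc`), then N549 `chebyshevS ∕ C_comp_X_add_two_coeff` and N551 `chebyshevU_comp_X_add_one_coeff`, `two_mul_chebyshevT_comp_X_add_one_coeff`.
DEDUP DISCLOSURE (`rg -n 'iterate_derivative.*nonneg|0 ≤ .*derivative\\^\\[' Summits/Ventures/HSemireg Literature Mathlib…Chebyshev`, 2026-09-05): the `T`-statement is ALSO an immediate corollary of Mathlib's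
extremal theorem `Polynomial.Chebyshev.eval_iterate_derivative_le_of_forall_abs_le_one` (take `P = 0`; cited) and, for `k`-th derivatives with `m ≤ n`, of `Literature…ChebyshevSubmultiplicative.
abs_iterate_derivative_T_le` (cited); neither the `U ∕ S ∕ C` statements nor the generic Taylor-coefficient criterion are in Mathlib or the tree; N522 ∕ N550 (monotonicity ∕ convexity, i.e. `k = 1, 2`) are the
low-order cases; 0 hits for the 6 names below.

WHAT IS IN THE TREE.  N549 `chebyshevS_comp_X_add_two_coeff`, `chebyshevC_comp_X_add_two_coeff`; N551 `iterate_derivative_eval_eq_factorial_mul_coeff`, `chebyshevU_comp_X_add_one_coeff`,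
`two_mul_chebyshevT_comp_X_add_one_coeff`; Mathlib `comp_eq_sum_left`, `Polynomial.sum_def`, `finsetSum_coeff`, `coeff_C_mul`, `coeff_X_add_C_pow`, `comp_assoc`, `iterate_derivative_zero`, `derivative_ofNat`,
`derivative_one`, `eval_iterate_derivative_le_of_forall_abs_le_one` (cited alternative for `T`).
THIS FILE (namespace `Summit.Ventures.HSemireg.Wedge.HankelOuter` continued; CHAINED on N551; 0 definitions):
* §1317 `coeff_comp_X_add_C_nonneg`, `iterate_derivative_eval_nonneg_of_coeff_comp_nonneg` (the criterion), **`iterate_derivative_chebyshevS_real_eval_nonneg`** (`x ≥ 2`),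
  **`iterate_derivative_chebyshevC_real_eval_nonneg`** (`x ≥ 2`), **`iterate_derivative_chebyshevU_real_eval_nonneg`** (`x ≥ 1`), **`iterate_derivative_chebyshevT_real_eval_nonneg`** (`x ≥ 1`).
CAVEATS.  `n, k ∈ ℕ`; non-strict inequalities (for `k ≤ n` and `x ≥ a` the values are in fact positive — not typed).  Nothing Ext-side.  New names only.
-/

open Module Polynomial
open scoped Matrix Polynomial Nat

namespace Summit.Ventures.HSemireg.Wedge.HankelOuter

/-! ## §1317. Nonnegativity of all derivatives beyond the endpoint -/

/-- If all coefficients of `q ∈ ℝ[X]` are `≥ 0` and `b ≥ 0`, then all coefficients of `q(X + b)` are `≥ 0`. [this file, §1317] -/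
theorem coeff_comp_X_add_C_nonneg {q : ℝ[X]} (hq : ∀ k, 0 ≤ q.coeff k) {b : ℝ} (hb : 0 ≤ b) (k : ℕ) : 0 ≤ (q.comp (X + Polynomial.C b)).coeff k := by
  rw [comp_eq_sum_left, Polynomial.sum_def, finsetSum_coeff]
  refine Finset.sum_nonneg fun i _ => ?_
  rw [coeff_C_mul, coeff_X_add_C_pow]
  exact mul_nonneg (hq i) (mul_nonneg (pow_nonneg hb _) (Nat.cast_nonneg _))

/-- **If all Taylor coefficients of `p ∈ ℝ[X]` at `a` are `≥ 0`, then `p^{(k)}(x) ≥ 0` for all `k` and all `x ≥ a`.** [this file, §1317] -/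
theorem iterate_derivative_eval_nonneg_of_coeff_comp_nonneg {p : ℝ[X]} {a : ℝ} (h : ∀ k, 0 ≤ (p.comp (X + Polynomial.C a)).coeff k) {x : ℝ} (hx : a ≤ x) (k : ℕ) :
    0 ≤ (derivative^[k] p).eval x := by
  have e : p.comp (X + Polynomial.C x) = (p.comp (X + Polynomial.C a)).comp (X + Polynomial.C (x - a)) := by
    rw [comp_assoc]
    congr 1
    simp only [add_comp, X_comp, C_comp, add_assoc, ← map_add, sub_add_cancel]
  rw [iterate_derivative_eval_eq_factorial_mul_coeff, e]
  exact mul_nonneg (Nat.cast_nonneg _) (coeff_comp_X_add_C_nonneg h (sub_nonneg.mpr hx) k)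

/-- **`S_n^{(k)}(x) ≥ 0` for `x ≥ 2`** (all `n, k ∈ ℕ`). [Rivlin 1974, §2.7 (rescaled); this file, §1317] -/
theorem iterate_derivative_chebyshevS_real_eval_nonneg (n k : ℕ) {x : ℝ} (hx : 2 ≤ x) : 0 ≤ (derivative^[k] (Polynomial.Chebyshev.S ℝ (n : ℤ))).eval x := by
  refine iterate_derivative_eval_nonneg_of_coeff_comp_nonneg (a := 2) (fun j => ?_) hx k
  rw [map_ofNat, chebyshevS_comp_X_add_two_coeff]
  exact Nat.cast_nonneg _

/-- **`C_n^{(k)}(x) ≥ 0` for `x ≥ 2`** (all `n, k ∈ ℕ`). [Rivlin 1974, §2.7 (rescaled); this file, §1317] -/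
theorem iterate_derivative_chebyshevC_real_eval_nonneg (n k : ℕ) {x : ℝ} (hx : 2 ≤ x) : 0 ≤ (derivative^[k] (Polynomial.Chebyshev.C ℝ (n : ℤ))).eval x := by
  match n with
  | 0 =>
    match k with
    | 0 => simp
    | k + 1 => rw [Function.iterate_succ_apply, Nat.cast_zero, Polynomial.Chebyshev.C_zero, derivative_ofNat, iterate_derivative_zero, eval_zero]
  | m + 1 =>
    refine iterate_derivative_eval_nonneg_of_coeff_comp_nonneg (a := 2) (fun j => ?_) hx k
    rw [map_ofNat, chebyshevC_comp_X_add_two_coeff]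
    positivity

/-- **`U_n^{(k)}(x) ≥ 0` for `x ≥ 1`** (all `n, k ∈ ℕ`). [Rivlin 1974, (1.98), §2.7; this file, §1317] -/
theorem iterate_derivative_chebyshevU_real_eval_nonneg (n k : ℕ) {x : ℝ} (hx : 1 ≤ x) : 0 ≤ (derivative^[k] (Polynomial.Chebyshev.U ℝ (n : ℤ))).eval x := by
  refine iterate_derivative_eval_nonneg_of_coeff_comp_nonneg (a := 1) (fun j => ?_) hx k
  rw [map_one, chebyshevU_comp_X_add_one_coeff]
  positivity

/-- **`T_n^{(k)}(x) ≥ 0` for `x ≥ 1`** (all `n, k ∈ ℕ`; equivalently Mathlib `eval_iterate_derivative_le_of_forall_abs_le_one` with `P = 0`). [Rivlin 1974, (1.97), §2.7; this file, §1317] -/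
theorem iterate_derivative_chebyshevT_real_eval_nonneg (n k : ℕ) {x : ℝ} (hx : 1 ≤ x) : 0 ≤ (derivative^[k] (Polynomial.Chebyshev.T ℝ (n : ℤ))).eval x := by
  match n with
  | 0 =>
    match k with
    | 0 => simp
    | k + 1 => rw [Function.iterate_succ_apply, Nat.cast_zero, Polynomial.Chebyshev.T_zero, derivative_one, iterate_derivative_zero, eval_zero]
  | m + 1 =>
    refine iterate_derivative_eval_nonneg_of_coeff_comp_nonneg (a := 1) (fun j => ?_) hx k
    have h := two_mul_chebyshevT_comp_X_add_one_coeff (R := ℝ) m j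
    rw [map_one]
    have h0 : (0 : ℝ) ≤ 2 ^ j * ((m + 1 + j).choose (2 * j) + (m + j).choose (2 * j) : ℝ) := by positivity
    linarith

end Summit.Ventures.HSemireg.Wedge.HankelOuter
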